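import Mathlib.Data.Fintype.Sum
import Mathlib.Data.Fintype.Prod
import Mathlib.Data.Fintype.BigOperators
import Mathlib.Algebra.BigOperators.Fin
import Mathlib.Algebra.Order.BigOperators.Group.Finset
import Mathlib.Tactic.FinCases
import Mathlib.Tactic.Linarith
import Mathlib.Tactic.Ring
import HarnessLib

/-!
# `B × E` for a CM abelian FOURFOLD `B` whose octic CM field contains the CM field `k` of the elliptic curve `E`, with
# `k`-signature `(1,3)`: the balanced weights of EVERY product of copies are lifted conjugate pairs and lifted `k`-Weil
# `6`-sets of the sixfold `B × E × E` — a frame-free, group-free kernel census (10-point model)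

COR-CM (cell `pub-hodgecm2`), seat b30 gen 18 (2026-08-21); count-neutral own lane OCTIC-EB (lit-andre-3's prover-lane ask
A6-R26, generalised).  Bookkeeping definitions and theorems of a finite model; no named fact, no geometry, no `sorry`.  The
pattern is seat b30 gen 15's `Census/DihedralSexticPairCurvePowers.lean` / seat b09 gen 18's
`Census/DecicCurveFivefoldPowers.lean`, with ONE new feature: the Weil generator uses the curve TWICE.

SETTING (formalised downstream, `CorCM/OcticCurveFourfoldFrameTransfer.lean`).  `F` a CM field of degree `8` containing an
imaginary quadratic field `k` (`i : k → F`; automatically `F = k·F⁺`), `τ : k → ℂ`, `E ⊨ (k; {τ})` a CM elliptic curve, and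
`B ⊨ (F; Φ)` a CM abelian fourfold whose type has `k`-SIGNATURE `(1,3)`: exactly ONE `s₊ ∈ Φ` restricts to `τ` along `i`
(so `Φ = {s₊} ⊔ {s̄ | s|_k = τ, s ≠ s₊}`).  NO Galois hypothesis on `F`, no group.

MODEL.  `Pt = Bool ⊕ (Fin 4 × Bool)`: `inl b` = the embedding of `k` of sign `b` (`true = τ`), `inr (a, b)` = the embedding of
`F` of sign `b` (`b = true` iff it restricts to `τ`) in the `a`-th conjugate pair, numbered so that `s₊ = inr (0, true)`;
complex conjugation `cj` flips the sign; the CM type is `phi = {inl true, inr (0,true)} ⊔ {inr (a,false) | a ≠ 0}`.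
POHLMANN'S CONDITION WITHOUT A GROUP.  For `ρ ∈ Aut(ℂ)` put `s_ρ = ρ⁻¹ ∘ s₊` (any label, by transitivity of `Aut(ℂ)` on
`Hom(F, ℂ)`); then `ρ ∘ s ∈ Φ ⟺ s = s_ρ ∨ (sign s ≠ sign s_ρ ∧ s ≠ s̄_ρ)` and `ρ ∘ σ ∈ {τ} ⟺ sign σ = sign s_ρ`, i.e.
`ρ⁻¹Φ = phiPre p` for `p = ` the model point of `s_ρ` (`phiPre (a, ε) = {inl ε, inr (a, ε)} ⊔ {inr (a', ¬ε) | a' ≠ a}`).  So a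
weight of a power `X = ⨁_j A(κ j)` — a CONFIGURATION `(T, v)`, `v` the copy-forgetting model map — is Galois balanced iff
`2 · #{x ∈ T | v x ∈ phiPre p} = |T|` for the eight `p` (`ModelBalanced v T`).

RESULTS (kernel).
* `modelBalanced_iff_counts` — balance depends only on the ten fibre counts `N(y) = #{x ∈ T | v x = y}`;
* **`exists_defect_of_modelBalanced`** — THE DEFECT LAW: there is ONE integer `t` with `N(inl true) − N(inl false) = 2t`
  and `N(inr (a,true)) − N(inr (a,false)) = t` for all four `a` (so the Hodge lattice of the whole `{B, E}`-slice is
  `⟨5 conjugate pairs⟩ ⊕ ℤ·w`, `w = 2·[τ] + Σ_a [(a, τ)]` the weight of the Weil line `⋀⁶ H¹(B × E × E)_τ` — lit-andre-3's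
  `Census/OcticTriquadraticWeilColumn` / `…C4C2NonsquareWeilColumn` for the two Galois types, here for every octic `F ⊇ k`);
* one copy of each factor (`B × E`, a fivefold): `N ≤ 1` on the curve labels forces `t = 0` — only divisor weights
  (`forall_count_eq_of_modelBalanced_of_card_le_one`), Moonen–Zarhin's case `X × E_k` with `X` a fourfold not of Weil type.
The sequel `Census/OcticCurveFourfoldParts.lean` extracts the generating parts (conjugate pairs; Weil parts = two curve
points of one sign from two copies of `E` + the four labels of `F` of that sign) and proves the induction principle.
[cite: Pohlmann1968, Thm 1] [cite: GaoUllmo2025, Thm 3.1] [cite: Milne2020HodgeClassesAV, 1.2 (a)]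
[cite: Deligne1982HodgeCycles, §5 (c)] [cite: MoonenZarhin1999LowDim, Thm. 0.1 (a)]

## References
* [Pohlmann1968] H. Pohlmann, Ann. of Math. 88 (1968), Thm 1.  [GaoUllmo2025] Z. Gao, E. Ullmo, J. Inst. Math. Jussieu
  25 (2025), Thm 3.1 (3.2).  [Milne2020HodgeClassesAV] J. S. Milne, arXiv:2010.08857, 1.2 (a), Thm. 1.
  [Deligne1982HodgeCycles] P. Deligne, LNM 900 (1982), §4 Prop. 4.4, §5 (c).  [MoonenZarhin1999LowDim] B. Moonen,
  Yu. Zarhin, Math. Ann. 315 (1999), Thm. 0.1 (a).  [Markman2025SecantWeil] E. Markman, arXiv:2502.03415, Thm 1.5.1.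

## Provenance
Exact python first (seat folder `work/scratch/octic_eb_model.py`): on all `4^{10}` exponent vectors with entries `≤ 3` the
eight equations hold iff the defect law holds (`1348` balanced vectors, `0` mismatches).
-/

namespace Summit.HodgeConjecture.CorCM.Census.OcticCurveFourfold

open Finset

/-! ### The model -/

/-- Points of `B × E`: `inl b` = the embedding of `k` of sign `b` (`true = τ`), `inr (a, b)` = the embedding of `F` of sign
`b` in the `a`-th conjugate pair (`inr (0, true) = s₊`, the member of `Φ` over `τ`). [cite: GaoUllmo2025, §2.1] -/
abbrev Pt : Type := Bool ⊕ (Fin 4 × Bool)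

/-- The sign of a point (`true` = restricts to `τ`). [folklore] -/
def sgn : Pt → Bool
  | Sum.inl b => b
  | Sum.inr p => p.2

/-- Complex conjugation on the model: the sign flips, the pair index stays. [folklore] -/
def cj : Pt → Pt
  | Sum.inl b => Sum.inl (!b)
  | Sum.inr p => Sum.inr (p.1, !p.2)

/-- Unfolding of `sgn` on the curve slot. [folklore] -/
@[simp] theorem sgn_inl (b : Bool) : sgn (Sum.inl b) = b := rfl

/-- Unfolding of `sgn` on the fourfold slot. [folklore] -/
@[simp] theorem sgn_inr (q : Fin 4 × Bool) : sgn (Sum.inr q) = q.2 := rfl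

/-- Unfolding of `cj` on the curve slot. [folklore] -/
theorem cj_inl (b : Bool) : cj (Sum.inl b) = Sum.inl (!b) := rfl

/-- Unfolding of `cj` on the fourfold slot. [folklore] -/
theorem cj_inr (a : Fin 4) (b : Bool) : cj (Sum.inr (a, b)) = Sum.inr (a, !b) := rfl

/-- `cj` is a fixed-point-free involution reversing the sign. [folklore] -/
theorem cj_facts : (∀ y : Pt, cj (cj y) = y) ∧ (∀ y : Pt, cj y ≠ y) ∧ (∀ y : Pt, sgn (cj y) = !sgn y) := by
  refine ⟨by decide +kernel, by decide +kernel, by decide +kernel⟩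

/-- The four elements of `Fin 4`. [folklore] -/
theorem fin4_cases : ∀ a : Fin 4, a = 0 ∨ a = 1 ∨ a = 2 ∨ a = 3 := by decide

/-- **`ρ⁻¹Φ` read in the model** (Boolean form): for the automorphism `ρ` of `ℂ` with `ρ⁻¹ ∘ s₊` the label `p = (a, ε)`, the
labels `s` with `ρ ∘ s ∈ Φ` are `s = (a, ε)` itself and the labels of the OTHER sign except the conjugate `(a, ¬ε)`; on the
curve the embedding of sign `ε` goes to `τ`. [cite: GaoUllmo2025, Thm 3.1 (3.2)] -/
def inPhiPre (p : Fin 4 × Bool) : Pt → Bool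
  | Sum.inl b => b == p.2
  | Sum.inr q => q == p || (q.2 != p.2 && q.1 != p.1)

/-- `ρ⁻¹Φ` as a finset of the model. [cite: GaoUllmo2025, Thm 3.1 (3.2)] -/
def phiPre (p : Fin 4 × Bool) : Finset Pt := univ.filter fun y => inPhiPre p y = true

/-- The CM type of `B × E` itself: `ρ = 1`, `s_ρ = s₊ = (0, true)`. [folklore] -/
def phi : Finset Pt := phiPre (0, true)

/-- Membership in `phiPre p` is the Boolean test. [folklore] -/
theorem mem_phiPre_iff (p : Fin 4 × Bool) (y : Pt) : y ∈ phiPre p ↔ inPhiPre p y = true := by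
  simp [phiPre]

/-- Membership in `phiPre p`, curve slot. [folklore] -/
theorem inl_mem_phiPre (p : Fin 4 × Bool) (b : Bool) : Sum.inl b ∈ phiPre p ↔ b = p.2 := by
  rw [mem_phiPre_iff, inPhiPre]
  simp

/-- Membership in `phiPre p`, fourfold slot. [folklore] -/
theorem inr_mem_phiPre (p q : Fin 4 × Bool) : Sum.inr q ∈ phiPre p ↔ q = p ∨ (q.2 ≠ p.2 ∧ q.1 ≠ p.1) := by
  rw [mem_phiPre_iff, inPhiPre]
  simp

/-- `phi = {inl true, inr (0,true), inr (1,false), inr (2,false), inr (3,false)}`: one label over `τ`, three over `τ̄`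
(`k`-signature `(1,3)`), and `τ` on the curve. [folklore] -/
theorem phi_eq : phi = {Sum.inl true, Sum.inr (0, true), Sum.inr (1, false), Sum.inr (2, false), Sum.inr (3, false)} := by
  decide +kernel

/-- Each `phiPre p` is a CM type of the model: exactly one of `y`, `cj y`; five points. [folklore] -/
theorem phiPre_isCMType : ∀ p : Fin 4 × Bool, (∀ y : Pt, (y ∈ phiPre p ↔ cj y ∉ phiPre p)) ∧ (phiPre p).card = 5 := by
  decide +kernel

/-! ### Balanced configurations -/

variable {α : Type*}

/-- **Pohlmann's condition for a configuration** `(T, v)` (a weight of a product of copies of `B`, `E` read in the 10-point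
model, `v` = the copy-forgetting model map): for each of the eight labels `p`, `2 · #{x ∈ T | v x ∈ ρ_p⁻¹Φ} = |T|`.
[cite: GaoUllmo2025, Thm 3.1 eq. (3.2)] -/
def ModelBalanced (v : α → Pt) (T : Finset α) : Prop :=
  ∀ p : Fin 4 × Bool, 2 * (T.filter fun x => v x ∈ phiPre p).card = T.card

variable (v : α → Pt)

/-- Unfolding. [cite: GaoUllmo2025, Thm 3.1 eq. (3.2)] -/
theorem modelBalanced_iff (T : Finset α) :
    ModelBalanced v T ↔ ∀ p : Fin 4 × Bool, 2 * (T.filter fun x => v x ∈ phiPre p).card = T.card :=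
  Iff.rfl

/-- The empty configuration is balanced. [folklore] -/
theorem modelBalanced_empty : ModelBalanced v (∅ : Finset α) := fun _ => by simp

variable {v}

/-- **Removing a balanced part keeps the balance.** [folklore] -/
theorem ModelBalanced.sdiff [DecidableEq α] {T G : Finset α} (hT : ModelBalanced v T) (hG : ModelBalanced v G)
    (hGT : G ⊆ T) : ModelBalanced v (T \ G) := by
  intro p
  have key : ∀ (Q : α → Prop) [DecidablePred Q],
      ((T \ G).filter Q).card = (T.filter Q).card - (G.filter Q).card := by
    intro Q _
    rw [← Finset.card_sdiff_of_subset (Finset.filter_subset_filter Q hGT)]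
    congr 1
    ext x
    simp only [Finset.mem_filter, Finset.mem_sdiff]
    tauto
  have h1 := hT p
  have h2 := hG p
  have h3 := Finset.card_sdiff_of_subset hGT
  have h4 : (G.filter fun x => v x ∈ phiPre p).card ≤ (T.filter fun x => v x ∈ phiPre p).card :=
    Finset.card_le_card (Finset.filter_subset_filter _ hGT)
  rw [key, h3]
  omega

/-- The union of two disjoint balanced configurations is balanced. [folklore] -/
theorem ModelBalanced.union [DecidableEq α] {G R : Finset α} (hG : ModelBalanced v G) (hR : ModelBalanced v R)
    (hGR : Disjoint G R) : ModelBalanced v (G ∪ R) := by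
  intro p
  rw [Finset.filter_union, Finset.card_union_of_disjoint (Finset.disjoint_filter_filter hGR),
    Finset.card_union_of_disjoint hGR, mul_add, hG p, hR p]

/-! ### Counting fibrewise: balance depends only on the ten counts -/

variable (v)

/-- `#{x ∈ T | v x ∈ W} = Σ_{y ∈ W} #{x ∈ T | v x = y}`. [folklore] -/
theorem card_filter_mem_eq_sum (T : Finset α) (W : Finset Pt) :
    (T.filter fun x => v x ∈ W).card = ∑ y ∈ W, (T.filter fun x => v x = y).card := by
  rw [Finset.card_eq_sum_card_fiberwise (f := v) (s := T.filter fun x => v x ∈ W) (t := W)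
    (fun x hx => (Finset.mem_filter.1 (Finset.mem_coe.1 hx)).2)]
  refine Finset.sum_congr rfl fun y hy => ?_
  congr 1
  ext x
  simp only [Finset.mem_filter]
  constructor
  · rintro ⟨⟨hx, -⟩, hxy⟩; exact ⟨hx, hxy⟩
  · rintro ⟨hx, hxy⟩; exact ⟨⟨hx, hxy ▸ hy⟩, hxy⟩

/-- `|T| = Σ_y #{x ∈ T | v x = y}` over the ten model points. [folklore] -/
theorem card_eq_sum (T : Finset α) : T.card = ∑ y : Pt, (T.filter fun x => v x = y).card := by
  rw [← card_filter_mem_eq_sum v T univ]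
  congr 1
  ext x
  simp

/-- **Balance read on the counts**: `(T, v)` is balanced iff its count function `N(y) = #{x ∈ T | v x = y}` satisfies
`2 Σ_{y ∈ phiPre p} N(y) = Σ_y N(y)` for the eight `p`. [cite: GaoUllmo2025, Thm 3.1] -/
theorem modelBalanced_iff_counts (T : Finset α) : ModelBalanced v T ↔
    ∀ p : Fin 4 × Bool, 2 * ∑ y ∈ phiPre p, (T.filter fun x => v x = y).card = ∑ y : Pt, (T.filter fun x => v x = y).card := by
  refine forall_congr' fun p => ?_
  rw [card_filter_mem_eq_sum, card_eq_sum v T]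

/-- A sum over the ten points, expanded. [folklore] -/
theorem sum_pt (N : Pt → ℕ) : ∑ y : Pt, N y = N (Sum.inl true) + N (Sum.inl false) +
    (N (Sum.inr (0, true)) + N (Sum.inr (0, false)) + N (Sum.inr (1, true)) + N (Sum.inr (1, false)) +
      N (Sum.inr (2, true)) + N (Sum.inr (2, false)) + N (Sum.inr (3, true)) + N (Sum.inr (3, false))) := by
  rw [Fintype.sum_sum_type, Fintype.sum_bool, Fintype.sum_prod_type, Fin.sum_univ_four, Fintype.sum_bool,
    Fintype.sum_bool, Fintype.sum_bool, Fintype.sum_bool]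
  ring

/-- The sums over `phiPre (a, ε)`, tabulated: `phiPre (a, true) = {inl true, inr (a,true)} ⊔ {inr (a',false) | a' ≠ a}`
and `phiPre (a, false) = {inl false, inr (a,false)} ⊔ {inr (a',true) | a' ≠ a}`. [folklore] -/
theorem phiPre_table :
    phiPre (0, true) = {Sum.inl true, Sum.inr (0, true), Sum.inr (1, false), Sum.inr (2, false), Sum.inr (3, false)} ∧
    phiPre (0, false) = {Sum.inl false, Sum.inr (0, false), Sum.inr (1, true), Sum.inr (2, true), Sum.inr (3, true)} ∧
    phiPre (1, true) = {Sum.inl true, Sum.inr (1, true), Sum.inr (0, false), Sum.inr (2, false), Sum.inr (3, false)} ∧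
    phiPre (1, false) = {Sum.inl false, Sum.inr (1, false), Sum.inr (0, true), Sum.inr (2, true), Sum.inr (3, true)} ∧
    phiPre (2, true) = {Sum.inl true, Sum.inr (2, true), Sum.inr (0, false), Sum.inr (1, false), Sum.inr (3, false)} ∧
    phiPre (2, false) = {Sum.inl false, Sum.inr (2, false), Sum.inr (0, true), Sum.inr (1, true), Sum.inr (3, true)} ∧
    phiPre (3, true) = {Sum.inl true, Sum.inr (3, true), Sum.inr (0, false), Sum.inr (1, false), Sum.inr (2, false)} ∧
    phiPre (3, false) = {Sum.inl false, Sum.inr (3, false), Sum.inr (0, true), Sum.inr (1, true), Sum.inr (2, true)} := by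
  refine ⟨?_, ?_, ?_, ?_, ?_, ?_, ?_, ?_⟩ <;> decide +kernel

/-- A five-point sum, expanded. [folklore] -/
theorem sum_five (N : Pt → ℕ) (y₁ y₂ y₃ y₄ y₅ : Pt) (h₁ : y₁ ∉ ({y₂, y₃, y₄, y₅} : Finset Pt))
    (h₂ : y₂ ∉ ({y₃, y₄, y₅} : Finset Pt)) (h₃ : y₃ ∉ ({y₄, y₅} : Finset Pt)) (h₄ : y₄ ≠ y₅) :
    ∑ y ∈ ({y₁, y₂, y₃, y₄, y₅} : Finset Pt), N y = N y₁ + N y₂ + N y₃ + N y₄ + N y₅ := by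
  rw [Finset.sum_insert h₁, Finset.sum_insert h₂, Finset.sum_insert h₃, Finset.sum_pair h₄]
  ring

/-- The eight sums `Σ_{y ∈ phiPre p} N y`, expanded. [folklore] -/
theorem sum_phiPre_table (N : Pt → ℕ) :
    ∑ y ∈ phiPre (0, true), N y = N (Sum.inl true) + N (Sum.inr (0, true)) + N (Sum.inr (1, false)) +
        N (Sum.inr (2, false)) + N (Sum.inr (3, false)) ∧
    ∑ y ∈ phiPre (0, false), N y = N (Sum.inl false) + N (Sum.inr (0, false)) + N (Sum.inr (1, true)) +
        N (Sum.inr (2, true)) + N (Sum.inr (3, true)) ∧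
    ∑ y ∈ phiPre (1, true), N y = N (Sum.inl true) + N (Sum.inr (1, true)) + N (Sum.inr (0, false)) +
        N (Sum.inr (2, false)) + N (Sum.inr (3, false)) ∧
    ∑ y ∈ phiPre (1, false), N y = N (Sum.inl false) + N (Sum.inr (1, false)) + N (Sum.inr (0, true)) +
        N (Sum.inr (2, true)) + N (Sum.inr (3, true)) ∧
    ∑ y ∈ phiPre (2, true), N y = N (Sum.inl true) + N (Sum.inr (2, true)) + N (Sum.inr (0, false)) +
        N (Sum.inr (1, false)) + N (Sum.inr (3, false)) ∧
    ∑ y ∈ phiPre (2, false), N y = N (Sum.inl false) + N (Sum.inr (2, false)) + N (Sum.inr (0, true)) +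
        N (Sum.inr (1, true)) + N (Sum.inr (3, true)) ∧
    ∑ y ∈ phiPre (3, true), N y = N (Sum.inl true) + N (Sum.inr (3, true)) + N (Sum.inr (0, false)) +
        N (Sum.inr (1, false)) + N (Sum.inr (2, false)) ∧
    ∑ y ∈ phiPre (3, false), N y = N (Sum.inl false) + N (Sum.inr (3, false)) + N (Sum.inr (0, true)) +
        N (Sum.inr (1, true)) + N (Sum.inr (2, true)) := by
  obtain ⟨e1, e2, e3, e4, e5, e6, e7, e8⟩ := phiPre_table
  rw [e1, e2, e3, e4, e5, e6, e7, e8]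
  refine ⟨?_, ?_, ?_, ?_, ?_, ?_, ?_, ?_⟩ <;> exact sum_five N _ _ _ _ _ (by decide) (by decide) (by decide) (by decide)

/-- **THE DEFECT LAW, on counts.**  If `N : Pt → ℕ` satisfies the eight balance equations then for ONE integer `t`:
`N(inl true) − N(inl false) = 2t` and `N(inr (a,true)) − N(inr (a,false)) = t` for `a = 0, 1, 2, 3`; and conversely.
(Subtract the equations of `(a, true)` and `(a, false)`: the difference `N(a,τ) − N(a,τ̄)` does not depend on `a`; sum
over `a`.) [cite: GaoUllmo2025, Thm 3.1] [cite: Pohlmann1968, Thm 1] -/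
theorem defect_iff_counts (N : Pt → ℕ) :
    (∀ p : Fin 4 × Bool, 2 * ∑ y ∈ phiPre p, N y = ∑ y : Pt, N y) ↔ ∃ t : ℤ,
      (N (Sum.inl true) : ℤ) - N (Sum.inl false) = 2 * t ∧
        ∀ a : Fin 4, (N (Sum.inr (a, true)) : ℤ) - N (Sum.inr (a, false)) = t := by
  obtain ⟨h0t, h0f, h1t, h1f, h2t, h2f, h3t, h3f⟩ := sum_phiPre_table N
  have htot := sum_pt N
  constructor
  · intro h
    have e0t := h (0, true); have e0f := h (0, false); have e1t := h (1, true); have e1f := h (1, false)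
    have e2t := h (2, true); have e2f := h (2, false); have e3t := h (3, true); have e3f := h (3, false)
    rw [h0t, htot] at e0t; rw [h0f, htot] at e0f; rw [h1t, htot] at e1t; rw [h1f, htot] at e1f
    rw [h2t, htot] at e2t; rw [h2f, htot] at e2f; rw [h3t, htot] at e3t; rw [h3f, htot] at e3f
    refine ⟨(N (Sum.inr (0, true)) : ℤ) - N (Sum.inr (0, false)), ?_, fun a => ?_⟩
    · omega
    · rcases fin4_cases a with rfl | rfl | rfl | rfl <;> omega
  · rintro ⟨t, hE, hB⟩ ⟨a, ε⟩
    have hB0 := hB 0; have hB1 := hB 1; have hB2 := hB 2; have hB3 := hB 3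
    rw [htot]
    rcases fin4_cases a with rfl | rfl | rfl | rfl <;> cases ε
    · rw [h0f]; omega
    · rw [h0t]; omega
    · rw [h1f]; omega
    · rw [h1t]; omega
    · rw [h2f]; omega
    · rw [h2t]; omega
    · rw [h3f]; omega
    · rw [h3t]; omega

variable {v}

/-- **THE DEFECT LAW of a balanced configuration.**  With `N(y) = #{x ∈ T | v x = y}` there is ONE integer `t` with
`N(inl true) − N(inl false) = 2t` and `N(inr (a,true)) − N(inr (a,false)) = t` for all `a`: every balanced weight of every
product of copies of `B`, `E` is `Σ (conjugate pairs) + t · w`, `w = 2[τ] + Σ_a [(a,τ)]` the Weil weight of `B × E × E`.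
[cite: GaoUllmo2025, Thm 3.1] [cite: Deligne1982HodgeCycles, §5 (c)] [cite: Markman2025SecantWeil, Thm 1.5.1] -/
theorem exists_defect_of_modelBalanced {T : Finset α} (hT : ModelBalanced v T) : ∃ t : ℤ,
    ((T.filter fun x => v x = Sum.inl true).card : ℤ) - (T.filter fun x => v x = Sum.inl false).card = 2 * t ∧
      ∀ a : Fin 4, ((T.filter fun x => v x = Sum.inr (a, true)).card : ℤ) -
        (T.filter fun x => v x = Sum.inr (a, false)).card = t :=
  (defect_iff_counts fun y => (T.filter fun x => v x = y).card).1 ((modelBalanced_iff_counts v T).1 hT)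

/-- Conversely, counts obeying the defect law are balanced. [cite: GaoUllmo2025, Thm 3.1] -/
theorem modelBalanced_of_defect {T : Finset α} (t : ℤ)
    (hE : ((T.filter fun x => v x = Sum.inl true).card : ℤ) - (T.filter fun x => v x = Sum.inl false).card = 2 * t)
    (hB : ∀ a : Fin 4, ((T.filter fun x => v x = Sum.inr (a, true)).card : ℤ) -
      (T.filter fun x => v x = Sum.inr (a, false)).card = t) : ModelBalanced v T :=
  (modelBalanced_iff_counts v T).2 ((defect_iff_counts fun y => (T.filter fun x => v x = y).card).2 ⟨t, hE, hB⟩)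

/-- **One copy of each factor** (the fivefold `B × E`, or any configuration with at most one point over each curve label):
`t = 0`, so a balanced configuration has conjugation-invariant counts — a disjoint union of pair parts, only divisor
weights, no Weil class on `B × E` itself (Moonen–Zarhin's `X × E_k` with `X` a fourfold NOT of Weil type).
[cite: MoonenZarhin1999LowDim, Thm. 0.1 (a)] -/
theorem forall_count_eq_of_modelBalanced_of_card_le_one {T : Finset α} (hT : ModelBalanced v T)
    (h1 : ∀ c : Bool, (T.filter fun x => v x = Sum.inl c).card ≤ 1) :
    ∀ y : Pt, (T.filter fun x => v x = y).card = (T.filter fun x => v x = cj y).card := by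
  obtain ⟨t, hEt, hBt⟩ := exists_defect_of_modelBalanced hT
  have ht : t = 0 := by
    have h := h1 true; have h' := h1 false; omega
  subst ht
  intro y
  rcases y with c | ⟨a, c⟩
  · cases c
    · rw [cj_inl, Bool.not_false]; omega
    · rw [cj_inl, Bool.not_true]; omega
  · have h := hBt a
    cases c
    · rw [cj_inr, Bool.not_false]; omega
    · rw [cj_inr, Bool.not_true]; omega

end Summit.HodgeConjecture.CorCM.Census.OcticCurveFourfold
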